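import Summits.CriticalPhenomena.PercolationContinuityZ3.Theorems.PercNearOneGluingNoHeavyLowerTailKnQuestion8CoefficientwiseCoreClassKernelMixShortThreadPrep
import Summits.CriticalPhenomena.PercolationContinuityZ3.Theorems.PercNearOneGluingNoHeavyLowerTailKnQuestion8CoefficientwiseCoreClassKernelMixBundleBoundaryIET
import Summits.CriticalPhenomena.PercolationContinuityZ3.Theorems.PercNearOneGluingNoHeavyLowerTailKnQuestion8CoefficientwiseCoreClassKernelMixCycleIET
import HarnessLib

/-!
# IET on bundles with at most two long threads — the two base cases (finset-indexed bundle data)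

Support file (`--supports stmt-CriticalPhenomena-4575`, closed), prover `prim-cplus-coupling` (gen 53).  No definitions, no notations, no named facts,
no sorries; standard axioms.  Memo `prim-cplus-coupling/A5-COUPLING-gen53.md` §1.4 (COROLLARY B).

The induction of …ShortThreadsMain runs over explicit bundles whose threads are indexed by a FINSET `T ⊆ ℕ` (so that a thread can be removed without
re-indexing).  This file restates the two base cases in that format:
* `iet_base_twoThreads` — `T = {p, q}`: the bundle is a cycle, IET by `iet_cycle` (gen 39);
* `iet_base_unitThread` — `T = {p, q, t₀}` with `L t₀ = 1`: every demand colouring has the edge `u b` blue and every supply colouring has it red, so the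
  IET sum IS the boundary functional of THEOREM BI (`iet_boundary_bundle`, gen 46), after re-indexing the three threads as `0, 1, 2`.
[cite: KozmaNitzan2024, Questions 8–9 (§5.5 p. 36) (context); Harris 1960]
-/

namespace Summit.CriticalPhenomena.PercolationContinuityZ3.Theorems

open Finset Literature.Probability.Percolation

namespace Coefficientwise

variable {ι V : Type*}

open Classical in
/-- **Base case r = 2 (a cycle).**  Finset-indexed bundle data with `T = {p, q}`: the IET sum is nonnegative, by `iet_cycle`.
[cite: KozmaNitzan2024, Questions 8–9 (§5.5 p. 36) (context)] -/
theorem iet_base_twoThreads (ends : ι → Sym2 V) (T : Finset ℕ) (L : ℕ → ℕ) (hL : ∀ t ∈ T, 1 ≤ L t)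
    (w : ℕ → ℕ → V) (e : ℕ → ℕ → ι) (u b : V)
    (hw0 : ∀ t ∈ T, w t 0 = u) (hwL : ∀ t ∈ T, w t (L t) = b)
    (harc : ∀ t ∈ T, ∀ j, 1 ≤ j → j ≤ L t → ends (e t j) = s(w t (j - 1), w t j))
    (hwinj : ∀ t ∈ T, ∀ i j, i ≤ L t → j ≤ L t → w t i = w t j → i = j)
    (hcross : ∀ t ∈ T, ∀ t' ∈ T, t ≠ t' → ∀ i j, i ≤ L t → j ≤ L t' → w t i = w t' j → (i = 0 ∧ j = 0) ∨ (i = L t ∧ j = L t'))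
    (A : ℕ → Finset ι) (hA : ∀ t ∈ T, ∀ i, i ∈ A t ↔ ∃ j, 1 ≤ j ∧ j ≤ L t ∧ e t j = i)
    (hAdisj : ∀ t ∈ T, ∀ t' ∈ T, t ≠ t' → Disjoint (A t) (A t'))
    (E : Finset ι) (hEA : ∀ i, i ∈ E ↔ ∃ t ∈ T, i ∈ A t)
    (p q : ℕ) (hp : p ∈ T) (hq : q ∈ T) (hpq : p ≠ q) (hT : ∀ t ∈ T, t = p ∨ t = q)
    (𝒱 : Finset ι → Prop) (hV : ∀ ⦃s t : Finset ι⦄, s ⊆ t → 𝒱 s → 𝒱 t)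
    (h k ha hb ka kb : Set V → ℝ) (mh : Monotone h) (mk : Monotone k)
    (mha : Monotone ha) (mhb : Monotone hb) (mka : Monotone ka) (mkb : Monotone kb)
    (ha0 : ∀ S, 0 ≤ ha S) (hah : ∀ S, ha S ≤ h S) (hb0 : ∀ S, 0 ≤ hb S) (hbh : ∀ S, hb S ≤ h S)
    (ka0 : ∀ S, 0 ≤ ka S) (kak : ∀ S, ka S ≤ k S) (kb0 : ∀ S, 0 ≤ kb S) (kbk : ∀ S, kb S ≤ k S) :
    0 ≤ (∑ ω ∈ E.powerset, if 𝒱 ω ∧ b ∈ openCluster (ends '' (↑ω : Set ι)) u ∧ b ∉ openCluster (ends '' (↑(E \ ω) : Set ι)) u then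
        h (openCluster (ends '' (↑ω : Set ι)) u) * k (openCluster (ends '' (↑ω : Set ι)) u) else 0)
      + ∑ ω ∈ E.powerset, if 𝒱 ω ∧ b ∈ openCluster (ends '' (↑(E \ ω) : Set ι)) u ∧ b ∉ openCluster (ends '' (↑ω : Set ι)) u then
        (ha (openCluster (ends '' (↑ω : Set ι)) u) - hb (openCluster (ends '' (↑(E \ ω) : Set ι)) u)) *
          (ka (openCluster (ends '' (↑ω : Set ι)) u) - kb (openCluster (ends '' (↑(E \ ω) : Set ι)) u)) else 0 := by
  have hE : E = A p ∪ A q := by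
    ext i
    rw [hEA i, Finset.mem_union]
    constructor
    · rintro ⟨t, ht, hi⟩
      rcases hT t ht with rfl | rfl
      · exact Or.inl hi
      · exact Or.inr hi
    · rintro (hi | hi)
      · exact ⟨p, hp, hi⟩
      · exact ⟨q, hq, hi⟩
  rw [hE]
  exact iet_cycle ends (L p) (L q) (hL p hp) (hL q hq) (w p) (w q) (e p) (e q) u b
    (hw0 p hp) (hwL p hp) (hw0 q hq) (hwL q hq) (harc p hp) (harc q hq) (hwinj p hp) (hwinj q hq)
    (arc_edge_inj ends (L p) (w p) (e p) (harc p hp) (hwinj p hp)) (arc_edge_inj ends (L q) (w q) (e q) (harc q hq) (hwinj q hq))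
    (hcross p hp q hq hpq) (A p) (A q) (hA p hp) (hA q hq) (hAdisj p hp q hq hpq)
    𝒱 hV h k ha hb ka kb mh mk mha mhb mka mkb ha0 hah hb0 hbh ka0 kak kb0 kbk

open Classical in
/-- **Base case Θ(ℓ_p, ℓ_q, 1).**  Finset-indexed bundle data with `T = {p, q, t₀}` and `L t₀ = 1`: the IET sum is nonnegative.  The single edge
`f = e t₀ 1` (with `ends f = s(u, b)`) is blue at every demand point and red at every supply point, so the IET sum is the boundary functional of
`iet_boundary_bundle` for the re-indexed threads `p ↦ 0, q ↦ 1, t₀ ↦ 2`. [cite: KozmaNitzan2024, Questions 8–9 (§5.5 p. 36) (context); Harris 1960] -/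
theorem iet_base_unitThread (ends : ι → Sym2 V) (T : Finset ℕ) (L : ℕ → ℕ) (hL : ∀ t ∈ T, 1 ≤ L t)
    (w : ℕ → ℕ → V) (e : ℕ → ℕ → ι) (u b : V)
    (hw0 : ∀ t ∈ T, w t 0 = u) (hwL : ∀ t ∈ T, w t (L t) = b)
    (harc : ∀ t ∈ T, ∀ j, 1 ≤ j → j ≤ L t → ends (e t j) = s(w t (j - 1), w t j))
    (hwinj : ∀ t ∈ T, ∀ i j, i ≤ L t → j ≤ L t → w t i = w t j → i = j)
    (hcross : ∀ t ∈ T, ∀ t' ∈ T, t ≠ t' → ∀ i j, i ≤ L t → j ≤ L t' → w t i = w t' j → (i = 0 ∧ j = 0) ∨ (i = L t ∧ j = L t'))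
    (A : ℕ → Finset ι) (hA : ∀ t ∈ T, ∀ i, i ∈ A t ↔ ∃ j, 1 ≤ j ∧ j ≤ L t ∧ e t j = i)
    (hAdisj : ∀ t ∈ T, ∀ t' ∈ T, t ≠ t' → Disjoint (A t) (A t'))
    (E : Finset ι) (hEA : ∀ i, i ∈ E ↔ ∃ t ∈ T, i ∈ A t)
    (p q t₀ : ℕ) (hp : p ∈ T) (hq : q ∈ T) (ht₀ : t₀ ∈ T) (hpq : p ≠ q) (ht₀p : t₀ ≠ p) (ht₀q : t₀ ≠ q)
    (hT : ∀ t ∈ T, t = p ∨ t = q ∨ t = t₀) (hL1 : L t₀ = 1)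
    (𝒱 : Finset ι → Prop) (hV : ∀ ⦃s t : Finset ι⦄, s ⊆ t → 𝒱 s → 𝒱 t)
    (h k ha hb ka kb : Set V → ℝ) (mh : Monotone h) (mk : Monotone k)
    (mha : Monotone ha) (mhb : Monotone hb) (mka : Monotone ka) (mkb : Monotone kb)
    (ha0 : ∀ S, 0 ≤ ha S) (hah : ∀ S, ha S ≤ h S) (hb0 : ∀ S, 0 ≤ hb S) (hbh : ∀ S, hb S ≤ h S)
    (ka0 : ∀ S, 0 ≤ ka S) (kak : ∀ S, ka S ≤ k S) (kb0 : ∀ S, 0 ≤ kb S) (kbk : ∀ S, kb S ≤ k S) :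
    0 ≤ (∑ ω ∈ E.powerset, if 𝒱 ω ∧ b ∈ openCluster (ends '' (↑ω : Set ι)) u ∧ b ∉ openCluster (ends '' (↑(E \ ω) : Set ι)) u then
        h (openCluster (ends '' (↑ω : Set ι)) u) * k (openCluster (ends '' (↑ω : Set ι)) u) else 0)
      + ∑ ω ∈ E.powerset, if 𝒱 ω ∧ b ∈ openCluster (ends '' (↑(E \ ω) : Set ι)) u ∧ b ∉ openCluster (ends '' (↑ω : Set ι)) u then
        (ha (openCluster (ends '' (↑ω : Set ι)) u) - hb (openCluster (ends '' (↑(E \ ω) : Set ι)) u)) *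
          (ka (openCluster (ends '' (↑ω : Set ι)) u) - kb (openCluster (ends '' (↑(E \ ω) : Set ι)) u)) else 0 := by
  set C : Finset ι → Set V := fun ω => openCluster (ends '' (↑ω : Set ι)) u with hC
  -- ### re-indexing p ↦ 0, q ↦ 1, t₀ ↦ 2
  set τ : ℕ → ℕ := fun t => if t = 0 then p else if t = 1 then q else t₀ with hτ
  have τ0 : τ 0 = p := by simp [hτ]
  have τ1 : τ 1 = q := by simp [hτ]
  have τ2 : τ 2 = t₀ := by simp [hτ]
  have τmem : ∀ t, t < 3 → τ t ∈ T := by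
    intro t ht
    rcases Nat.lt_trichotomy t 1 with h0 | rfl | h2
    · have : t = 0 := by omega
      rw [this, τ0]; exact hp
    · rw [τ1]; exact hq
    · have : t = 2 := by omega
      rw [this, τ2]; exact ht₀
  have τinj : ∀ t t', t < 3 → t' < 3 → t ≠ t' → τ t ≠ τ t' := by
    intro t t' ht ht' hne heq
    have key : ∀ s, s < 3 → (τ s = p ↔ s = 0) ∧ (τ s = q ↔ s = 1) ∧ (τ s = t₀ ↔ s = 2) := by
      intro s hs
      rcases Nat.lt_trichotomy s 1 with h0 | rfl | h2
      · have : s = 0 := by omega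
        subst this; rw [τ0]; exact ⟨by simp, ⟨fun h => absurd h.symm hpq.symm, by omega⟩, ⟨fun h => absurd h.symm ht₀p, by omega⟩⟩
      · rw [τ1]; exact ⟨⟨fun h => absurd h hpq.symm, by omega⟩, by simp, ⟨fun h => absurd h.symm ht₀q, by omega⟩⟩
      · have : s = 2 := by omega
        subst this; rw [τ2]; exact ⟨⟨fun h => absurd h ht₀p, by omega⟩, ⟨fun h => absurd h ht₀q, by omega⟩, by simp⟩
    rcases Nat.lt_trichotomy t 1 with h0 | rfl | h2
    · have : t = 0 := by omega
      subst this
      rw [τ0] at heq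
      exact hne ((key t' ht').1.mp heq.symm).symm
    · rw [τ1] at heq
      exact hne ((key t' ht').2.1.mp heq.symm).symm
    · have : t = 2 := by omega
      subst this
      rw [τ2] at heq
      exact hne ((key t' ht').2.2.mp heq.symm).symm
  have hEA3 : ∀ i, i ∈ E ↔ ∃ t, t < 3 ∧ i ∈ A (τ t) := by
    intro i
    rw [hEA i]
    constructor
    · rintro ⟨t, ht, hi⟩
      rcases hT t ht with rfl | rfl | rfl
      · exact ⟨0, by omega, by rw [τ0]; exact hi⟩
      · exact ⟨1, by omega, by rw [τ1]; exact hi⟩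
      · exact ⟨2, by omega, by rw [τ2]; exact hi⟩
    · rintro ⟨t, ht, hi⟩
      exact ⟨τ t, τmem t ht, hi⟩
  have bi := iet_boundary_bundle ends 3 (fun t => L (τ t)) (fun t ht => hL _ (τmem t ht))
    (fun t => w (τ t)) (fun t => e (τ t)) u b (fun t ht => hw0 _ (τmem t ht)) (fun t ht => hwL _ (τmem t ht))
    (fun t ht => harc _ (τmem t ht)) (fun t ht => hwinj _ (τmem t ht))
    (fun t t' ht ht' hne => hcross _ (τmem t ht) _ (τmem t' ht') (τinj t t' ht ht' hne))
    (fun t => A (τ t)) (fun t ht => hA _ (τmem t ht)) (fun t t' ht ht' hne => hAdisj _ (τmem t ht) _ (τmem t' ht') (τinj t t' ht ht' hne))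
    E hEA3 0 1 (by omega) (by omega) (by omega) 2 (by omega) (by omega) (by omega)
    𝒱 hV h k ha hb ka kb mh mk mha mhb mka mkb ha0 hah hb0 hbh ka0 kak kb0 kbk
  simp only [τ0, τ1] at bi
  -- ### the edge f = e t₀ 1 carries s(u,b): supply has it red, demand has it blue
  set f : ι := e t₀ 1 with hfdef
  have hf : ends f = s(u, b) := by
    have := harc t₀ ht₀ 1 (le_refl _) (by rw [hL1])
    rw [hw0 t₀ ht₀] at this
    rw [← hL1, hwL t₀ ht₀] at this
    rw [hL1] at this; exact this
  have hAt₀ : ∀ i, i ∈ A t₀ ↔ i = f := by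
    intro i
    rw [hA t₀ ht₀ i]
    constructor
    · rintro ⟨j, hj1, hjL, rfl⟩
      rw [hL1] at hjL
      have : j = 1 := by omega
      rw [this]
    · rintro rfl; exact ⟨1, le_refl _, by rw [hL1], rfl⟩
  have hfE : f ∈ E := (hEA f).mpr ⟨t₀, ht₀, (hAt₀ f).mpr rfl⟩
  have hO : E \ (A p ∪ A q) = A t₀ := by
    ext i
    rw [Finset.mem_sdiff, Finset.mem_union, hAt₀]
    constructor
    · rintro ⟨hiE, hnot⟩
      obtain ⟨t, ht, hi⟩ := (hEA i).mp hiE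
      rcases hT t ht with rfl | rfl | rfl
      · exact absurd (Or.inl hi) hnot
      · exact absurd (Or.inr hi) hnot
      · exact (hAt₀ i).mp hi
    · rintro rfl
      refine ⟨hfE, ?_⟩
      rintro (hi | hi)
      · exact Finset.disjoint_left.mp (hAdisj t₀ ht₀ p hp ht₀p) ((hAt₀ f).mpr rfl) hi
      · exact Finset.disjoint_left.mp (hAdisj t₀ ht₀ q hq ht₀q) ((hAt₀ f).mpr rfl) hi
  rw [hO] at bi
  have hb_red : ∀ ω : Finset ι, f ∈ ω → b ∈ C ω := by
    intro ω hfω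
    exact mem_openCluster_of_edge ends hfω hf (mem_openCluster_self _ _)
  -- termwise identification with the boundary functional
  refine le_trans bi (le_of_eq ?_)
  congr 1
  · apply Finset.sum_congr rfl
    intro ω hω
    rw [Finset.mem_powerset] at hω
    apply ite_zero_congr _ (fun _ => rfl)
    constructor
    · rintro ⟨⟨hv, _⟩, hc⟩; exact ⟨hv, hc⟩
    · rintro ⟨hv, hbX, hbY⟩
      refine ⟨⟨hv, ?_⟩, hbX, hbY⟩
      intro i hi
      rw [(hAt₀ i).mp hi]
      by_contra hfω
      exact hbY (hb_red (E \ ω) (Finset.mem_sdiff.mpr ⟨hfE, hfω⟩))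
  · apply Finset.sum_congr rfl
    intro ω hω
    rw [Finset.mem_powerset] at hω
    apply ite_zero_congr _ (fun _ => rfl)
    constructor
    · rintro ⟨⟨hv, _⟩, hc⟩; exact ⟨hv, hc⟩
    · rintro ⟨hv, hbY, hbX⟩
      refine ⟨⟨hv, ?_⟩, hbY, hbX⟩
      intro i hi
      have hiE := hω hi
      rw [Finset.mem_union]
      obtain ⟨t, ht, hit⟩ := (hEA i).mp hiE
      rcases hT t ht with rfl | rfl | rfl
      · exact Or.inl hit
      · exact Or.inr hit
      · exfalso
        rw [hAt₀] at hit
        subst hit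
        exact hbX (hb_red ω hi)


/-- **Replacing a thread by a single `u–b` edge keeps explicit bundle data.**  For finset-indexed bundle data and a thread `t₀ ∈ T`, put `f = e t₀ 1`,
`ends′ = ends[f ↦ s(u,b)]`, `L′ = L[t₀ ↦ 1]`, `w′ = w[t₀ ↦ (0 ↦ u, else b)]`, `A′ = A[t₀ ↦ {f}]`, `E′ = (E ∖ A t₀) + f`: all bundle hypotheses hold for the
primed data. (Used by the induction of …ShortThreadsMain.) [folklore] -/
theorem bundleData_unitReplace [DecidableEq ι] (ends : ι → Sym2 V) (T : Finset ℕ) (L : ℕ → ℕ) (hL : ∀ t ∈ T, 1 ≤ L t)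
    (w : ℕ → ℕ → V) (e : ℕ → ℕ → ι) (u b : V)
    (hw0 : ∀ t ∈ T, w t 0 = u) (hwL : ∀ t ∈ T, w t (L t) = b)
    (harc : ∀ t ∈ T, ∀ j, 1 ≤ j → j ≤ L t → ends (e t j) = s(w t (j - 1), w t j))
    (hwinj : ∀ t ∈ T, ∀ i j, i ≤ L t → j ≤ L t → w t i = w t j → i = j)
    (hcross : ∀ t ∈ T, ∀ t' ∈ T, t ≠ t' → ∀ i j, i ≤ L t → j ≤ L t' → w t i = w t' j → (i = 0 ∧ j = 0) ∨ (i = L t ∧ j = L t'))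
    (A : ℕ → Finset ι) (hA : ∀ t ∈ T, ∀ i, i ∈ A t ↔ ∃ j, 1 ≤ j ∧ j ≤ L t ∧ e t j = i)
    (hAdisj : ∀ t ∈ T, ∀ t' ∈ T, t ≠ t' → Disjoint (A t) (A t'))
    (E : Finset ι) (hEA : ∀ i, i ∈ E ↔ ∃ t ∈ T, i ∈ A t) (t₀ : ℕ) (ht₀ : t₀ ∈ T) :
    (∀ t ∈ T, 1 ≤ Function.update L t₀ 1 t) ∧
    (∀ t ∈ T, Function.update w t₀ (fun j => if j = 0 then u else b) t 0 = u) ∧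
    (∀ t ∈ T, Function.update w t₀ (fun j => if j = 0 then u else b) t (Function.update L t₀ 1 t) = b) ∧
    (∀ t ∈ T, ∀ j, 1 ≤ j → j ≤ Function.update L t₀ 1 t →
      Function.update ends (e t₀ 1) s(u, b) (e t j) =
        s(Function.update w t₀ (fun j => if j = 0 then u else b) t (j - 1), Function.update w t₀ (fun j => if j = 0 then u else b) t j)) ∧
    (∀ t ∈ T, ∀ i j, i ≤ Function.update L t₀ 1 t → j ≤ Function.update L t₀ 1 t →
      Function.update w t₀ (fun j => if j = 0 then u else b) t i = Function.update w t₀ (fun j => if j = 0 then u else b) t j → i = j) ∧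
    (∀ t ∈ T, ∀ t' ∈ T, t ≠ t' → ∀ i j, i ≤ Function.update L t₀ 1 t → j ≤ Function.update L t₀ 1 t' →
      Function.update w t₀ (fun j => if j = 0 then u else b) t i = Function.update w t₀ (fun j => if j = 0 then u else b) t' j →
        (i = 0 ∧ j = 0) ∨ (i = Function.update L t₀ 1 t ∧ j = Function.update L t₀ 1 t')) ∧
    (∀ t ∈ T, ∀ i, i ∈ Function.update A t₀ {e t₀ 1} t ↔ ∃ j, 1 ≤ j ∧ j ≤ Function.update L t₀ 1 t ∧ e t j = i) ∧
    (∀ t ∈ T, ∀ t' ∈ T, t ≠ t' → Disjoint (Function.update A t₀ {e t₀ 1} t) (Function.update A t₀ {e t₀ 1} t')) ∧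
    (∀ i, i ∈ insert (e t₀ 1) (E \ A t₀) ↔ ∃ t ∈ T, i ∈ Function.update A t₀ {e t₀ 1} t) := by
  have hub : u ≠ b := by
    intro hub
    have := hwinj t₀ ht₀ 0 (L t₀) (Nat.zero_le _) (le_refl _) ((hw0 t₀ ht₀).trans (hub.trans (hwL t₀ ht₀).symm))
    have := hL t₀ ht₀; omega
  have hfA : e t₀ 1 ∈ A t₀ := (hA t₀ ht₀ _).mpr ⟨1, le_refl _, hL t₀ ht₀, rfl⟩
  have hne_f : ∀ t ∈ T, t ≠ t₀ → ∀ j, 1 ≤ j → j ≤ L t → e t j ≠ e t₀ 1 := by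
    intro t ht hne j hj1 hjL heq
    have hi : e t j ∈ A t := (hA t ht _).mpr ⟨j, hj1, hjL, rfl⟩
    exact Finset.disjoint_left.mp (hAdisj t ht t₀ ht₀ hne) hi (heq ▸ hfA)
  have huw : ∀ s ∈ T, ∀ j', j' ≤ L s → u = w s j' → j' = 0 := fun s hs j' hj' heq =>
    (hwinj s hs 0 j' (Nat.zero_le _) hj' ((hw0 s hs).trans heq)).symm
  have hbw : ∀ s ∈ T, ∀ j', j' ≤ L s → b = w s j' → j' = L s := fun s hs j' hj' heq =>
    (hwinj s hs (L s) j' (le_refl _) hj' ((hwL s hs).trans heq)).symm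
  refine ⟨?_, ?_, ?_, ?_, ?_, ?_, ?_, ?_, ?_⟩
  · intro t ht
    by_cases htt : t = t₀
    · subst htt; simp only [Function.update_self]; omega
    · simp only [Function.update_of_ne htt]; exact hL t ht
  · intro t ht
    by_cases htt : t = t₀
    · subst htt; simp only [Function.update_self]; rfl
    · simp only [Function.update_of_ne htt]; exact hw0 t ht
  · intro t ht
    by_cases htt : t = t₀
    · subst htt; simp only [Function.update_self]; simp
    · simp only [Function.update_of_ne htt]; exact hwL t ht
  · intro t ht j hj1 hjL
    by_cases htt : t = t₀
    · subst htt
      simp only [Function.update_self] at hjL ⊢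
      have hj : j = 1 := by omega
      subst hj
      simp only [Nat.sub_self, if_true]
      rw [if_neg (by omega), Function.update_self]
    · simp only [Function.update_of_ne htt] at hjL ⊢
      rw [Function.update_of_ne (hne_f t ht htt j hj1 hjL)]
      exact harc t ht j hj1 hjL
  · intro t ht i j hi hj hij
    by_cases htt : t = t₀
    · subst htt
      simp only [Function.update_self] at hi hj hij
      by_contra hne
      have : (if i = 0 then u else b) ≠ (if j = 0 then u else b) := by
        rcases Nat.eq_zero_or_pos i with rfl | hi0 <;> rcases Nat.eq_zero_or_pos j with rfl | hj0
        · exact absurd rfl hne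
        · rw [if_pos rfl, if_neg (by omega)]; exact hub
        · rw [if_neg (by omega), if_pos rfl]; exact hub.symm
        · omega
      exact this hij
    · simp only [Function.update_of_ne htt] at hi hj hij
      exact hwinj t ht i j hi hj hij
  · intro t ht t' ht' hne i j hi hj hij
    by_cases htt : t = t₀
    · subst htt
      rw [Function.update_of_ne (Ne.symm hne)] at hj hij
      simp only [Function.update_self] at hi hij ⊢
      rcases Nat.eq_zero_or_pos i with rfl | hi0
      · rw [if_pos rfl] at hij
        exact Or.inl ⟨rfl, huw t' ht' j hj hij⟩
      · rw [if_neg (by omega)] at hij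
        right
        rw [Function.update_of_ne (Ne.symm hne)]
        exact ⟨by omega, hbw t' ht' j hj hij⟩
    · by_cases htt' : t' = t₀
      · subst htt'
        rw [Function.update_of_ne hne] at hi hij ⊢
        simp only [Function.update_self] at hj hij ⊢
        rcases Nat.eq_zero_or_pos j with rfl | hj0
        · rw [if_pos rfl] at hij
          exact Or.inl ⟨huw t ht i hi hij.symm, rfl⟩
        · rw [if_neg (by omega)] at hij
          exact Or.inr ⟨hbw t ht i hi hij.symm, by omega⟩
      · rw [Function.update_of_ne htt] at hi ⊢
        rw [Function.update_of_ne htt'] at hj ⊢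
        rw [Function.update_of_ne htt, Function.update_of_ne htt'] at hij
        exact hcross t ht t' ht' hne i j hi hj hij
  · intro t ht i
    by_cases htt : t = t₀
    · subst htt
      simp only [Function.update_self, Finset.mem_singleton]
      constructor
      · rintro rfl; exact ⟨1, le_refl _, le_refl _, rfl⟩
      · rintro ⟨j, hj1, hjL, rfl⟩
        have : j = 1 := by omega
        rw [this]
    · simp only [Function.update_of_ne htt]
      exact hA t ht i
  · intro t ht t' ht' hne
    by_cases htt : t = t₀
    · subst htt
      rw [Function.update_self, Function.update_of_ne (Ne.symm hne)]
      exact Finset.disjoint_of_subset_left (Finset.singleton_subset_iff.mpr hfA) (hAdisj t ht t' ht' hne)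
    · by_cases htt' : t' = t₀
      · subst htt'
        rw [Function.update_self, Function.update_of_ne hne]
        exact Finset.disjoint_of_subset_right (Finset.singleton_subset_iff.mpr hfA) (hAdisj t ht t' ht' hne)
      · rw [Function.update_of_ne htt, Function.update_of_ne htt']
        exact hAdisj t ht t' ht' hne
  · intro i
    rw [Finset.mem_insert, Finset.mem_sdiff, hEA i]
    constructor
    · rintro (rfl | ⟨⟨t, ht, hit⟩, hni⟩)
      · exact ⟨t₀, ht₀, by rw [Function.update_self]; exact Finset.mem_singleton_self _⟩
      · have htt : t ≠ t₀ := by rintro rfl; exact hni hit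
        exact ⟨t, ht, by rw [Function.update_of_ne htt]; exact hit⟩
    · rintro ⟨t, ht, hit⟩
      by_cases htt : t = t₀
      · subst htt
        rw [Function.update_self, Finset.mem_singleton] at hit
        exact Or.inl hit
      · rw [Function.update_of_ne htt] at hit
        exact Or.inr ⟨⟨t, ht, hit⟩, fun hi' => Finset.disjoint_left.mp (hAdisj t ht t₀ ht₀ htt) hit hi'⟩

/-- The event `ω ↦ 𝒱(ω + g if f ∈ ω else ω)` is up-closed when `𝒱` is. [folklore] -/
theorem upClosed_insert_if [DecidableEq ι] (𝒱 : Finset ι → Prop) (hV : ∀ ⦃s t : Finset ι⦄, s ⊆ t → 𝒱 s → 𝒱 t) (f g : ι) :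
    ∀ ⦃s t : Finset ι⦄, s ⊆ t → 𝒱 (if f ∈ s then insert g s else s) → 𝒱 (if f ∈ t then insert g t else t) := by
  intro s t hst hs
  by_cases hfs : f ∈ s
  · have hft : f ∈ t := hst hfs
    rw [if_pos hfs] at hs
    rw [if_pos hft]
    exact hV (Finset.insert_subset_insert g hst) hs
  · rw [if_neg hfs] at hs
    by_cases hft : f ∈ t
    · rw [if_pos hft]
      exact hV (hst.trans (Finset.subset_insert g t)) hs
    · rw [if_neg hft]
      exact hV hst hs

end Coefficientwise

end Summit.CriticalPhenomena.PercolationContinuityZ3.Theorems
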